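import Summits.BirchSwinnertonDyer.BirchSwinnertonDyer.Theorems.SemiOrdinaryEisensteinDescentWildSplitEisensteinInclusionAtThreeRankOneRestriction
import Summits.BirchSwinnertonDyer.BirchSwinnertonDyer.Theorems.SemiOrdinaryEisensteinDescentWildKolyvaginUpperAtThreeTight
import Summits.BirchSwinnertonDyer.BirchSwinnertonDyer.Theorems.SchneiderFreeAdditiveX3StepLEquivBranch
import Literature.NumberTheory.EllipticCurves.StrictSelmerRankOneDegreeOneProofs
import HarnessLib

/-!
# Route `SemiOrdinaryEisensteinDescent`, Eisenstein crux E / E′ (stmt-BirchSwinnertonDyer-20479 /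
# stmt-BirchSwinnertonDyer-24155): the kernel's Eisenstein input in its MINIMAL currency `E_𝟙^V` is
# TIGHT — EQUIVALENT to the leaf `WAllExclAddWildRankOneSurj` modulo the route's other items
# (cell `pub/bsd-wall`, width seat `bsd-wall-soed-p1-w2` g4; `--supports 20479`, helper; BSD is not proved by any of this)

WHY. The route's kernel (`EisensteinKernelAtThree`, and the restricted kernel′
`EisensteinKernelAtThreeRestricted`, item 24156, fed by the restricted crux E′
`WildSplitEisensteinInclusionAtThreeRestricted`, item 24155, since route rev 7) consumes the
Λ-adic Eisenstein inclusion ONLY through the value-at-`𝟙` inequality `‖f(𝟙)‖₃ ≤ ‖L(𝟙)‖`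
(`…RankOneRestriction.wAllExclAddWildRankOneSurj_of_valueAtOneRestricted`, p588074 §3), and only
AT THE WALDSPURGER FRAME — the frame `(ι′, Ω_K, Ω_p, L)` delivered by crux #4
`WildSplitWaldspurgerAtThree`, which carries a unit value display `L(𝟙) = u·(log_ω P/c)²` — over the
Friedberg–Hoffstein field, whose discriminant is ODD. Call that statement `E_𝟙^V` (displayed below:
E′'s binders verbatim + `Odd d_K` + the value display as a hypothesis). The companion file
`…WildKolyvaginUpperAtThreeTight` (soed-p2 g2, p584719) proved that the Kolyvagin crux Ko is implied
by the leaf and Z; THIS FILE proves the Eisenstein mirror: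

* `valueAtOneV_of_wAllExclAddWildRankOneSurj` — **`PublishedInputsWildThree → WildSplitControlAtThree →
  WildRankZeroTwistAtThree → WAllExclAddWildRankOneSurj → E_𝟙^V`**: the leaf (BSD₃ on the onto wild
  rank-one rows) and the rank-zero residual Z (BSD₃ of the Heegner twist) give BOTH Heegner-index
  sockets at slack `v₃(c)` (soed-p2 g2's `indexBounds_of_bsdp_of_partner_bsdp`); the STEP-L socket and
  the control count C at `𝔭′` give T-B6-1 at slack `v₃(c)` (K1 door,
  `SchneiderFreeAdditiveX3.additiveIMCLowerBDPOnTreeLeAt_of_indexLowerBoundLeAt_of_control`); and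
  T-B6-1 plus the unit value display IS the norm inequality (§1–§2 here, the converse of w3 g0's
  `two_mul_valuation_le_of_norm_constantCoeff_le`). So `E_𝟙^V` carries NO SURPLUS over BSD₃: no
  counterexample to `E_𝟙^V` exists short of a counterexample to BSD₃ on the cell (given C).
* `wAllExclAddWildRankOneSurj_of_valueAtOneV` — the kernel re-run from `E_𝟙^V` (p588074 §3 verbatim
  with the two extra arguments `hodd`, `u hval` the kernel holds at that point): `E_𝟙^V` SUFFICES.
* `wAllExclAddWildRankOneSurj_iff_valueAtOneV` — **modulo {PUB, Ko, V, C, Z, NT}: leaf ⟺ `E_𝟙^V`.**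
* `valueAtOneV_of_restricted`, `valueAtOneV_of_crux` — E′ ⟹ `E_𝟙^V` and E ⟹ `E_𝟙^V` BY NAME: what the
  cruxes of record assert BEYOND kernel need is exactly {even-`d_K` Heegner fields} ∪ {frames / branches
  `ι′` without a unit value display} ∪ {the Λ-adic content above `T = 0`} (the last = UTD's wall S by
  p588074 §4) — and, for E, the `r_an(E/K) ≥ 3` corner (p588074 §2).

Frame level (any prime `p`, Theses-free): `norm_constantCoeff_le_of_two_mul_valuation_le` /
`norm_constantCoeff_le_iff_two_mul_valuation_le` (§1, pure algebra in `R₀⟦T⟧`);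
`norm_constantCoeff_le_of_imcLowerLe` / `imcLowerLe_iff_forall_norm_constantCoeff_le` (§2: T-B6-1 at
slack `v_p(c)` ⟺ the norm inequality for every generator, given CTL₀ and a unit value display).

HONEST STATUS: bookkeeping only — every conjectural statement (leaf, Z, C, Ko, V, NT, PUB's print facts)
is a HYPOTHESIS; nothing is asserted about any curve; no engine for E / E′ / `E_𝟙^V` is claimed (walls
W1–W3 of `Cruxes/WildSplitEisensteinInclusionAtThree/Lines/birth-dead*.md` stand); the crux is NOT
claimed false; BSD is not proved for any curve. No definition, no named fact, no `sorry`.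

References: [JetchevSkinnerWan2017] §7.4.1 (arXiv:1512.06894 p. 30); [GrossZagier1986] Thm. I.(6.3),
(7.3), V §2; [Gross1991] Thm. 1.3; [Castella2018] Thm. 2.3, §5; [BertoliniDarmonPrasanna2013] Thm. 5.13;
[FriedbergHoffstein1995] Thm. B; [Miller2011LMS] Def. 1.1.
-/

set_option autoImplicit false
set_option linter.dupNamespace false -- `Summit.BirchSwinnertonDyer.BirchSwinnertonDyer.Theorems.…` (summit = sub)

noncomputable section

open scoped Classical

namespace Summit.BirchSwinnertonDyer.BirchSwinnertonDyer.Theorems.WildSplitEisensteinInclusionAtThreeTight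

open WeierstrassCurve NumberField IsDedekindDomain Field PowerSeries
  Literature.NumberTheory.EllipticCurves
  Literature.NumberTheory.EllipticCurves.ModularForms
  Literature.NumberTheory.EllipticCurves.Rank1Residual
  Literature.NumberTheory.EllipticCurves.KrizLi2019
  Summit.BirchSwinnertonDyer.Rank1Residual
  Summit.BirchSwinnertonDyer.Rank1Residual.Additive
  Summit.BirchSwinnertonDyer.Rank1Residual.X11b
  Summit.BirchSwinnertonDyer.Rank1Residual.X11b.AcSelmer
  Summit.BirchSwinnertonDyer.Rank1Residual.X11b.Halves
  Summit.BirchSwinnertonDyer.BirchSwinnertonDyer.Theses.SemiOrdinaryEisensteinDescent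
  Summit.BirchSwinnertonDyer.BirchSwinnertonDyer.Theorems
  Summit.BirchSwinnertonDyer.BirchSwinnertonDyer.Theorems.WildSplitEisensteinInclusionAtThreeValueAtOne
  Summit.BirchSwinnertonDyer.BirchSwinnertonDyer.Theorems.WildSplitEisensteinInclusionAtThreeRankOneRestriction

/-! ### §1 Algebra in `R₀⟦T⟧` (any prime): the norm inequality at `T = 0` from the valuation inequality -/

section Algebra

variable (p : ℕ) [Fact p.Prime]

/-- **Converse of `two_mul_valuation_le_of_norm_constantCoeff_le`.** If `f(0) ≠ 0`, `L(0) = u·y²` with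
`u ∈ R₀ˣ`, `y ∈ ℚ_pˣ`, and `2·ord_p y ≤ ord_p f(0)`, then `‖f(0)‖ ≤ ‖L(0)‖` in `ℂ_p`
(`‖f(0)‖ = p^{-ord f(0)} ≤ p^{-2 ord y} = ‖y‖² = ‖L(0)‖`). [folklore] -/
theorem norm_constantCoeff_le_of_two_mul_valuation_le {f : IwasawaAlgebra p} (hf0 : constantCoeff f ≠ 0)
    {L : UnrSeries p} (u : (unrIntegers p)ˣ) {y : ℚ_[p]} (hy0 : y ≠ 0)
    (hL : L.HasValueAt 0 (((u : unrIntegers p) : ℂ_[p]) * (algebraMap ℚ_[p] ℂ_[p] y) ^ 2))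
    (hle : 2 * y.valuation ≤ ((constantCoeff f).valuation : ℤ)) :
    ‖((constantCoeff f : ℤ_[p]) : ℚ_[p])‖ ≤ ‖((constantCoeff L : unrIntegers p) : ℂ_[p])‖ := by
  have hL0 : ((u : unrIntegers p) : ℂ_[p]) * (algebraMap ℚ_[p] ℂ_[p] y) ^ 2 =
      ((constantCoeff L : unrIntegers p) : ℂ_[p]) :=
    UnrSeries.eq_constantCoeff_of_hasValueAt_zero hL
  have hp1 : (1 : ℝ) < p := by exact_mod_cast (Fact.out : p.Prime).one_lt
  calc ‖((constantCoeff f : ℤ_[p]) : ℚ_[p])‖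
      = (p : ℝ) ^ (-((constantCoeff f).valuation : ℤ)) := by
        rw [← PadicInt.norm_def, PadicInt.norm_eq_zpow_neg_valuation hf0]
    _ ≤ ((p : ℝ) ^ (-y.valuation)) ^ 2 := by
        rw [← zpow_natCast ((p : ℝ) ^ (-y.valuation)) 2, ← zpow_mul, zpow_le_zpow_iff_right₀ hp1]
        push_cast
        omega
    _ = ‖y‖ ^ 2 := by rw [Padic.norm_eq_zpow_neg_valuation hy0]
    _ = ‖((constantCoeff L : unrIntegers p) : ℂ_[p])‖ := by
        rw [← hL0, norm_mul, norm_pow, norm_coe_units_unrIntegers, one_mul, norm_algebraMap']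

/-- **The value-at-`𝟙` inequality in the two currencies.** With `f(0) ≠ 0` (CTL₀) and a unit value
display `L(0) = u·y²`, `y ≠ 0`: `‖f(0)‖ ≤ ‖L(0)‖ ⟺ 2·ord_p y ≤ ord_p f(0)`. [folklore] -/
theorem norm_constantCoeff_le_iff_two_mul_valuation_le {f : IwasawaAlgebra p}
    (hf0 : constantCoeff f ≠ 0) {L : UnrSeries p} (u : (unrIntegers p)ˣ) {y : ℚ_[p]} (hy0 : y ≠ 0)
    (hL : L.HasValueAt 0 (((u : unrIntegers p) : ℂ_[p]) * (algebraMap ℚ_[p] ℂ_[p] y) ^ 2)) :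
    ‖((constantCoeff f : ℤ_[p]) : ℚ_[p])‖ ≤ ‖((constantCoeff L : unrIntegers p) : ℂ_[p])‖ ↔
      2 * y.valuation ≤ ((constantCoeff f).valuation : ℤ) :=
  ⟨fun h ↦ (two_mul_valuation_le_of_norm_constantCoeff_le p hf0 h u hL).2,
    norm_constantCoeff_le_of_two_mul_valuation_le p hf0 u hy0 hL⟩

end Algebra

/-! ### §2 One frame: T-B6-1 at slack `v_p(c)` ⟺ the norm inequality for every generator -/

section Frame

variable {p : ℕ} [Fact p.Prime] {K : Type} [Field K] [NumberField K]
  {W : WeierstrassCurve ℚ} [W.IsElliptic] [W.IsGloballyMinimal] {κ : ZpExtension K p}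
  {𝔭 : HeightOneSpectrum (𝓞 K)} {γ : Field.absoluteGaloisGroup K} [Fact (κ.IsTopGenerator γ)]
  {ι₀ : K →+* ℚ_[p]} {P : (W.baseChange K).toAffine.Point} {c : ℤ}

/-- **T-B6-1 at slack `v_p(c)` ⟹ `‖f(𝟙)‖ ≤ ‖L(𝟙)‖` for every generator `f` of `Ch_Λ(X_(∅,0))`**, at a
frame where `L(𝟙) = u·(log_ω P/c)²` with `u ∈ R₀ˣ` (`c ≠ 0`, `log_ω P ≠ 0`): the generator the socket
names and `f` generate the same ideal, so `ord_p f(0) = n`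
(`valuation_constantCoeff_eq_of_span_singleton_eq`), and `2·(ord_p log_ω P − v_p(c)) ≤ n` is the socket
inequality. [cite: JetchevSkinnerWan2017, §7.4.1 (arXiv:1512.06894 p. 30)] -/
theorem norm_constantCoeff_le_of_imcLowerLe (hc0 : c ≠ 0) (hlog : logOmega W p ι₀ P ≠ 0)
    (h1 : SchneiderFree.AdditiveIMCLowerBDPOnTreeLeAt p κ 𝔭 γ ι₀ (padicValNat p c.natAbs) P)
    {L : UnrSeries p} (u : (unrIntegers p)ˣ)
    (hval : L.HasValueAt 0 (((u : unrIntegers p) : ℂ_[p]) *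
      (algebraMap ℚ_[p] ℂ_[p] (logOmega W p ι₀ P / (c : ℚ_[p]))) ^ 2))
    {f : IwasawaAlgebra p} (hfI : XAc.charIdeal (W.baseChange K) p κ 𝔭 ∅ γ = Ideal.span {f}) :
    ‖((constantCoeff f : ℤ_[p]) : ℚ_[p])‖ ≤ ‖((constantCoeff L : unrIntegers p) : ℂ_[p])‖ := by
  obtain ⟨n, ⟨-, g, hgI, hg0, hgn⟩, hle⟩ := h1
  obtain ⟨hf0, hfg⟩ :=
    Summit.BirchSwinnertonDyer.Rank1Residual.X11b.AcSelmer.valuation_constantCoeff_eq_of_span_singleton_eq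
      (hgI.symm.trans hfI) hg0
  have hc0' : (c : ℚ_[p]) ≠ 0 := by exact_mod_cast hc0
  have hy0 : logOmega W p ι₀ P / (c : ℚ_[p]) ≠ 0 := div_ne_zero hlog hc0'
  refine norm_constantCoeff_le_of_two_mul_valuation_le p hf0 u hy0 hval ?_
  rw [hfg, hgn, div_eq_mul_inv, Padic.valuation_mul hlog (inv_ne_zero hc0'), Padic.valuation_inv,
    Padic.valuation_intCast, valuation_logOmega hlog]
  simp only [padicValInt]
  linarith

/-- **Conversely, and together: given CTL₀ at the frame** (`X_(∅,0)` torsion with a generator non-zero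
at `𝟙`, e.g. from the control count), **T-B6-1 at slack `v_p(c)` ⟺ `‖f(𝟙)‖ ≤ ‖L(𝟙)‖ for every
generator `f`**, at a frame with a unit value display. [cite: JetchevSkinnerWan2017, §7.4.1 (arXiv:1512.06894 p. 30)] -/
theorem imcLowerLe_iff_forall_norm_constantCoeff_le (hc0 : c ≠ 0) (hlog : logOmega W p ι₀ P ≠ 0)
    {n : ℕ} (hn : XAc.HasCharValuationAt (W.baseChange K) p κ 𝔭 ∅ γ n)
    {L : UnrSeries p} (u : (unrIntegers p)ˣ)
    (hval : L.HasValueAt 0 (((u : unrIntegers p) : ℂ_[p]) *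
      (algebraMap ℚ_[p] ℂ_[p] (logOmega W p ι₀ P / (c : ℚ_[p]))) ^ 2)) :
    SchneiderFree.AdditiveIMCLowerBDPOnTreeLeAt p κ 𝔭 γ ι₀ (padicValNat p c.natAbs) P ↔
      ∀ f : IwasawaAlgebra p, XAc.charIdeal (W.baseChange K) p κ 𝔭 ∅ γ = Ideal.span {f} →
        ‖((constantCoeff f : ℤ_[p]) : ℚ_[p])‖ ≤ ‖((constantCoeff L : unrIntegers p) : ℂ_[p])‖ := by
  refine ⟨fun h1 f hfI ↦ norm_constantCoeff_le_of_imcLowerLe hc0 hlog h1 u hval hfI, fun h ↦ ?_⟩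
  obtain ⟨htors, g, hgI, hg0, hgn⟩ := hn
  have hc0' : (c : ℚ_[p]) ≠ 0 := by exact_mod_cast hc0
  obtain ⟨-, hle⟩ := two_mul_valuation_le_of_norm_constantCoeff_le p hg0 (h g hgI) u hval
  rw [hgn, div_eq_mul_inv, Padic.valuation_mul hlog (inv_ne_zero hc0'), Padic.valuation_inv,
    Padic.valuation_intCast, valuation_logOmega hlog] at hle
  simp only [padicValInt] at hle
  refine ⟨n, ⟨htors, g, hgI, hg0, hgn⟩, ?_⟩
  linarith

end Frame

/-! ### §3 `E_𝟙^V` is BSD-tight: leaf + Z + C + PUB ⟹ `E_𝟙^V`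

`E_𝟙^V` (displayed as the conclusion below) = E′'s binders VERBATIM, then `Odd (d_K)`, then — after the
frame binders — a unit value display `L(𝟙) = u·(log_{ω,𝔭} P/c(Dt))²` as a HYPOTHESIS, then E_𝟙′'s
conclusion `‖f(𝟙)‖₃ ≤ ‖L(𝟙)‖` for every generator `f` of `Ch_Λ(X_(∅,0))` at `𝔭′`. -/

/-- **`E_𝟙^V` is implied by the leaf**: `PublishedInputsWildThree → WildSplitControlAtThree →
WildRankZeroTwistAtThree → WAllExclAddWildRankOneSurj → E_𝟙^V`. Proof: the leaf gives `BSD₃(E)` (`E` is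
non-CM as `ρ̄₃` is onto); Z gives `BSD₃` of a globally minimal model of `E^{(d_K)}` (an O6 row of analytic
rank `0`, `classO6_twist_of_heegner`); both give the STEP-L socket at slack `v₃(c)`
(`WildKolyvaginUpperAtThreeTight.indexBounds_of_bsdp_of_partner_bsdp`); with Kolyvagin's finiteness and
the control count at `𝔭′` this is T-B6-1 at slack `v₃(c)`
(`SchneiderFreeAdditiveX3.additiveIMCLowerBDPOnTreeLeAt_of_indexLowerBoundLeAt_of_control`); the value
display, moved from `𝔭` to `𝔭′` in rank one, turns it into the norm inequality (§2). Every conjectural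
input is a hypothesis; nothing is asserted about any curve.
[cite: JetchevSkinnerWan2017, §7.4.1 (arXiv:1512.06894 p. 30)] [cite: GrossZagier1986, Thm. I.(6.3) and (7.3)]
[cite: Gross1991, Thm. 1.3] -/
theorem valueAtOneV_of_wAllExclAddWildRankOneSurj (hF : PublishedInputsWildThree)
    (hC : WildSplitControlAtThree) (hZ : WildRankZeroTwistAtThree)
    (hleaf : Summit.BirchSwinnertonDyer.WAllExclAddWildRankOneSurj) :
    ∀ (W : WeierstrassCurve ℚ) [W.IsElliptic] [W.IsGloballyMinimal] (N : ℕ) [NeZero N] (K : Type) [Field K] [NumberField K] (Dt : Literature.NumberTheory.EllipticCurves.ModularForms.ModularParametrizationData W N) (H : Literature.NumberTheory.EllipticCurves.HeegnerDatum N (NumberField.discr K)) (ι : K →+* ℂ) (P : (W.baseChange K).toAffine.Point), Summit.BirchSwinnertonDyer.Rank1Residual.Additive.ClassO6 W 3 → W.HasSurjectiveModNGaloisRep 3 → W.analyticRank = 1 → W.conductorNorm ℤ = N → Literature.NumberTheory.EllipticCurves.IsImaginaryQuadratic K → Literature.NumberTheory.EllipticCurves.SatisfiesHeegnerHypothesis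 N K → (W.quadraticTwist (NumberField.discr K : ℚ)).entireLFunction 1 ≠ 0 → (WeierstrassCurve.Affine.Point.map ι.toRatAlgHom) P = Literature.NumberTheory.EllipticCurves.ModularForms.heegnerPointComplex Dt H → ¬ IsOfFinAddOrder P → Odd (NumberField.discr K) → ∀ (κ : Literature.NumberTheory.EllipticCurves.ZpExtension K 3), κ.IsAnticyclotomic → ∀ (γ : Field.absoluteGaloisGroup K) [Fact (κ.IsTopGenerator γ)] (𝔭 : IsDedekindDomain.HeightOneSpectrum (NumberField.RingOfIntegers K)) (h𝔭 : ((3 : ℕ) : NumberField.RingOfIntegers K) ∈ 𝔭.asIdeal) (he : 𝔭.asIdeal.ramificationIdx (NumberField.RingOfIntegers ℚ) = 1) (hf : 𝔭.asIdeal.inertiaDeg (NumberField.RingOfIntegers ℚ) = 1), ∀ (𝔭' : IsDedekindDomain.HeightOneSpectrum (NumberField.RingOfIntegers K)), ((3 : ℕ) : NumberField.RingOfIntegers K) ∈ 𝔭'.asIdeal → 𝔭' ≠ 𝔭 → ∀ (ι' : PadicAlgCl 3 ≃+* ℂ), Summit.BirchSwinnertonDyer.BirchSwinnertonDyer.Theorems.SchneiderFree.BranchInducesPrime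 3 ι' 𝔭 → ∀ (ΩK : ℂ) (Ωp : ℂ_[3]) (L : Literature.NumberTheory.EllipticCurves.UnrSeries 3), ΩK ≠ 0 → Ωp ≠ 0 → Literature.NumberTheory.EllipticCurves.IsBDPLFunction ι' 𝔭 κ γ Dt.f ΩK Ωp L → Module.IsTorsion (Literature.NumberTheory.EllipticCurves.IwasawaAlgebra 3) (Summit.BirchSwinnertonDyer.Rank1Residual.X11b.AcSelmer.XAc (W.baseChange K) 3 κ 𝔭' ∅ γ) → ∀ (u : (Literature.NumberTheory.EllipticCurves.unrIntegers 3)ˣ), L.HasValueAt 0 ((((u : Literature.NumberTheory.EllipticCurves.unrIntegers 3) : Literature.NumberTheory.EllipticCurves.unrIntegers 3) : ℂ_[3]) * (algebraMap ℚ_[3] ℂ_[3] (Summit.BirchSwinnertonDyer.Rank1Residual.X11b.Halves.logOmega W 3 (Summit.BirchSwinnertonDyer.Rank1Residual.X11b.embAt K 3 𝔭 h𝔭 he hf) P / (Dt.c : ℚ_[3]))) ^ 2) → ∀ (f : Literature.NumberTheory.EllipticCurves.IwasawaAlgebra 3), Summit.BirchSwinnertonDyer.Rank1Residual.X11b.AcSelmer.XAc.charIdeal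 (W.baseChange K) 3 κ 𝔭' ∅ γ = Ideal.span {f} → ‖((PowerSeries.constantCoeff f : ℤ_[3]) : ℚ_[3])‖ ≤ ‖((PowerSeries.constantCoeff L : Literature.NumberTheory.EllipticCurves.unrIntegers 3) : ℂ_[3])‖ := by
  intro W _ _ N _ K _ _ Dt H ι P hO6 hsurj hr hN hK hHH hLt hP hnt hodd κ hκ γ _ 𝔭 h𝔭 he hf 𝔭' h𝔭' hne ι'
    hι' ΩK Ωp L hΩK hΩp hBDP htor u hval f hfI
  obtain ⟨hGZ, hKo, hGZK, hmod, -, -, hGZ73, -, -, -⟩ := hF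
  -- the leaf: `BSD₃(E)` (`E` is non-CM since `ρ̄₃` is onto)
  have hCM : ¬ W.HasCM := fun hCM ↦
    W.not_hasSurjectiveModNGaloisRep_of_hasCM hCM Nat.prime_three (by decide) hsurj
  have hWB : BSDp W 3 := hleaf W hCM hO6 hsurj hr
  -- the residual Z: `BSD₃` of a globally minimal model of the twist (an O6 row of analytic rank `0`)
  have hZ' : Summit.BirchSwinnertonDyer.WAllExclAddWildRankZero := hZ
  have hD0 : (NumberField.discr K : ℚ) ≠ 0 := by exact_mod_cast NumberField.discr_ne_zero K
  haveI : (W.quadraticTwist (NumberField.discr K : ℚ)).IsElliptic := W.isElliptic_quadraticTwist hD0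
  obtain ⟨Cd, hCd⟩ := hasGlobalMinimalModel_rat_holds (W.quadraticTwist (NumberField.discr K : ℚ))
  haveI : (Cd • W.quadraticTwist (NumberField.discr K : ℚ)).IsGloballyMinimal := hCd
  have hHN' : SatisfiesHeegnerHypothesis (W.conductorNorm ℤ) K := by rw [hN]; exact hHH
  obtain ⟨hO6d, hjd⟩ := classO6_twist_of_heegner W hO6 K hK hHN' hodd
    (Cd • W.quadraticTwist (NumberField.discr K : ℚ)) Cd rfl
  have hCMd : ¬ (Cd • W.quadraticTwist (NumberField.discr K : ℚ)).HasCM := fun h ↦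
    hCM ((hasCM_iff_of_j_eq hjd).mp h)
  have hLd1 : (Cd • W.quadraticTwist (NumberField.discr K : ℚ)).entireLFunction 1 ≠ 0 := by
    rw [entireLFunction_smul]; exact hLt
  have hrd : (Cd • W.quadraticTwist (NumberField.discr K : ℚ)).analyticRank = 0 :=
    analyticRank_eq_zero_of_entireLFunction_one_ne_zero _ hLd1
  have hWdB : BSDp (Cd • W.quadraticTwist (NumberField.discr K : ℚ)) 3 := hZ' _ hCMd hO6d hrd
  -- `3 ∣ N` splits in `K`: `3 ∤ #𝓞_K^×`, and `𝔭′` has degree one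
  have h3N : 3 ∣ W.conductorNorm ℤ :=
    (W.dvd_conductorNorm_iff_not_hasGoodReductionAtPrime 3).mpr (not_good_of_addv W 3 hO6.2.1)
  have hpN : 3 ∣ N := hN ▸ h3N
  have hw : ¬ 3 ∣ Units.torsionOrder K :=
    (X11b.Three.not_dvd_discr_and_not_dvd_torsionOrder_of_heegner hK hHH (by decide) hpN).2
  obtain ⟨he', hf'⟩ :=
    Literature.NumberTheory.EllipticCurves.ramificationIdx_eq_one_and_inertiaDeg_eq_one_of_ncard_primesOver_eq_two
      3 hK.1 (hHH 3 Nat.prime_three hpN) 𝔭' h𝔭'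
  -- the STEP-L socket at slack `v₃(c)` from the two `BSD₃`'s (soed-p2 g2, Tight §4)
  have hlo : SchneiderFree.IndexLowerBoundLeAt W 3 K P (padicValNat 3 Dt.c.natAbs) :=
    (WildKolyvaginUpperAtThreeTight.indexBounds_of_bsdp_of_partner_bsdp hGZ hKo hGZK hmod hGZ73 W 3 N K
      Dt H ι P (Cd • W.quadraticTwist (NumberField.discr K : ℚ)) hr hN hpN hK hodd hw hHH hLt hP
      ⟨Cd, rfl⟩ (by decide) hWB hWdB).1
  -- Kolyvagin: `rank E(K) = 1`, `Ш(E/K)` finite; the control count at `𝔭′`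
  obtain ⟨hrk, hfin⟩ := hKo N W K hK hHH ⟨Dt, H, ι, hP⟩ hnt
  have hctl : SchneiderFree.AdditiveControlOnTreeAt 3 κ 𝔭' γ (embAt K 3 𝔭' h𝔭' he' hf') P :=
    hC W N K Dt H ι P hO6 hsurj hr hN hK hHH hLt hP hnt (hKo N W K) κ hκ γ 𝔭' h𝔭' he' hf'
  -- T-B6-1 at slack `v₃(c)` at the frame `(κ, 𝔭′, γ)` (K1 door, StepLEquivBranch §1)
  have himc : SchneiderFree.AdditiveIMCLowerBDPOnTreeLeAt 3 κ 𝔭' γ (embAt K 3 𝔭' h𝔭' he' hf')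
      (padicValNat 3 Dt.c.natAbs) P :=
    SchneiderFreeAdditiveX3.additiveIMCLowerBDPOnTreeLeAt_of_indexLowerBoundLeAt_of_control hN hK hHH
      hfin hlo hctl
  -- the value display read at `𝔭′` (rank one: `(log_{𝔭′} P)² = (log_𝔭 P)²`), then §2
  have hval' := (SchneiderFreeAdditiveX3.hasValueAt_sq_logOmega_embAt_iff_of_rank_one W 3 hK.1 hrk h𝔭
    he hf h𝔭' he' hf' P _ _ L).mpr hval
  exact norm_constantCoeff_le_of_imcLowerLe Dt.maninConstant_ne_zero_holds
    (X11b.R1.logOmega_ne_zero W 3 _ hnt) himc u hval' hfI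

/-! ### §4 `E_𝟙^V` suffices: the kernel re-run (p588074 §3 verbatim, Eisenstein step fed by `E_𝟙^V`) -/

/-- **SOED's leaf from `E_𝟙^V`.** `PublishedInputsWildThree → E_𝟙^V → WildKolyvaginUpperAtThree →
WildSplitWaldspurgerAtThree → WildSplitControlAtThree → WildRankZeroTwistAtThree →
WildRankOneSurjNonTowerAtThree → WAllExclAddWildRankOneSurj` — the kernel
(`…RankOneRestriction.wAllExclAddWildRankOneSurj_of_valueAtOneRestricted`, itself bed-p3 g1's kernel)
VERBATIM; the only change is that the Eisenstein step receives the two extra arguments the kernel holds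
at that point: `hodd` (the Friedberg–Hoffstein field has `2` split, so `d_K` is odd) and the unit value
display `u, hval` of the Waldspurger crux. So the kernel's use of E / E′ factors through `E_𝟙^V`. Every
crux is an antecedent; BSD is not proved by this.
[cite: JetchevSkinnerWan2017, §7.4.1 (arXiv:1512.06894 p. 30)] [cite: Castella2018, Thm. 2.3 and §5 (5.1)–(5.3)]
[cite: GrossZagier1986, Thm. I.(6.3) and V.§2] [cite: FriedbergHoffstein1995, Thm. B] -/
theorem wAllExclAddWildRankOneSurj_of_valueAtOneV (hF : PublishedInputsWildThree)
    (hE1V : ∀ (W : WeierstrassCurve ℚ) [W.IsElliptic] [W.IsGloballyMinimal] (N : ℕ) [NeZero N] (K : Type) [Field K] [NumberField K] (Dt : Literature.NumberTheory.EllipticCurves.ModularForms.ModularParametrizationData W N) (H : Literature.NumberTheory.EllipticCurves.HeegnerDatum N (NumberField.discr K)) (ι : K →+* ℂ) (P : (W.baseChange K).toAffine.Point), Summit.BirchSwinnertonDyer.Rank1Residual.Additive.ClassO6 W 3 → W.HasSurjectiveModNGaloisRep 3 → W.analyticRank = 1 → W.conductorNorm ℤ = N → Literature.NumberTheory.EllipticCurves.IsImaginaryQuadratic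 K → Literature.NumberTheory.EllipticCurves.SatisfiesHeegnerHypothesis N K → (W.quadraticTwist (NumberField.discr K : ℚ)).entireLFunction 1 ≠ 0 → (WeierstrassCurve.Affine.Point.map ι.toRatAlgHom) P = Literature.NumberTheory.EllipticCurves.ModularForms.heegnerPointComplex Dt H → ¬ IsOfFinAddOrder P → Odd (NumberField.discr K) → ∀ (κ : Literature.NumberTheory.EllipticCurves.ZpExtension K 3), κ.IsAnticyclotomic → ∀ (γ : Field.absoluteGaloisGroup K) [Fact (κ.IsTopGenerator γ)] (𝔭 : IsDedekindDomain.HeightOneSpectrum (NumberField.RingOfIntegers K)) (h𝔭 : ((3 : ℕ) : NumberField.RingOfIntegers K) ∈ 𝔭.asIdeal) (he : 𝔭.asIdeal.ramificationIdx (NumberField.RingOfIntegers ℚ) = 1) (hf : 𝔭.asIdeal.inertiaDeg (NumberField.RingOfIntegers ℚ) = 1), ∀ (𝔭' : IsDedekindDomain.HeightOneSpectrum (NumberField.RingOfIntegers K)), ((3 : ℕ) : NumberField.RingOfIntegers K) ∈ 𝔭'.asIdeal → 𝔭' ≠ 𝔭 → ∀ (ι' : PadicAlgCl 3 ≃+*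 ℂ), Summit.BirchSwinnertonDyer.BirchSwinnertonDyer.Theorems.SchneiderFree.BranchInducesPrime 3 ι' 𝔭 → ∀ (ΩK : ℂ) (Ωp : ℂ_[3]) (L : Literature.NumberTheory.EllipticCurves.UnrSeries 3), ΩK ≠ 0 → Ωp ≠ 0 → Literature.NumberTheory.EllipticCurves.IsBDPLFunction ι' 𝔭 κ γ Dt.f ΩK Ωp L → Module.IsTorsion (Literature.NumberTheory.EllipticCurves.IwasawaAlgebra 3) (Summit.BirchSwinnertonDyer.Rank1Residual.X11b.AcSelmer.XAc (W.baseChange K) 3 κ 𝔭' ∅ γ) → ∀ (u : (Literature.NumberTheory.EllipticCurves.unrIntegers 3)ˣ), L.HasValueAt 0 ((((u : Literature.NumberTheory.EllipticCurves.unrIntegers 3) : Literature.NumberTheory.EllipticCurves.unrIntegers 3) : ℂ_[3]) * (algebraMap ℚ_[3] ℂ_[3] (Summit.BirchSwinnertonDyer.Rank1Residual.X11b.Halves.logOmega W 3 (Summit.BirchSwinnertonDyer.Rank1Residual.X11b.embAt K 3 𝔭 h𝔭 he hf) P / (Dt.c : ℚ_[3]))) ^ 2) → ∀ (f : Literature.NumberTheory.EllipticCurves.IwasawaAlgebra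 3), Summit.BirchSwinnertonDyer.Rank1Residual.X11b.AcSelmer.XAc.charIdeal (W.baseChange K) 3 κ 𝔭' ∅ γ = Ideal.span {f} → ‖((PowerSeries.constantCoeff f : ℤ_[3]) : ℚ_[3])‖ ≤ ‖((PowerSeries.constantCoeff L : Literature.NumberTheory.EllipticCurves.unrIntegers 3) : ℂ_[3])‖)
    (hKoly : WildKolyvaginUpperAtThree) (hV : WildSplitWaldspurgerAtThree) (hC : WildSplitControlAtThree)
    (hZ : WildRankZeroTwistAtThree) (hNT : WildRankOneSurjNonTowerAtThree) :
    Summit.BirchSwinnertonDyer.WAllExclAddWildRankOneSurj := by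
  unfold Summit.BirchSwinnertonDyer.WAllExclAddWildRankOneSurj
  intro W _ _ hncm hO6 hsurj hr
  -- (o) TOWER SPLIT: off the tower-surjective rows the residual crux pays by name
  by_cases htower : AdditiveThree.TowerSurjThree W
  swap
  · exact hNT W hncm hO6 hsurj htower hr
  obtain ⟨hGZ, hKo, hGZK, hmod, hmodP, -, hGZ73, hFH, hpar, hHP⟩ := hF
  haveI hN0 : NeZero (W.conductorNorm ℤ) := ⟨W.conductorNorm_pos_holds.ne'⟩
  -- (a) DATA. parity: `r_an = 1` is odd, so `w(E) = -1`
  have hw : W.rootNumber = -1 := by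
    rcases W.rootNumber_eq_one_or with h | h
    · exfalso
      have heven : Even W.analyticRank := (hpar W).mpr h
      rw [hr] at heven
      exact Nat.not_even_one heven
    · exact h
  -- Friedberg–Hoffstein with auxiliary modulus `2`: Heegner for `N(E)`, `2` split, `L(E^{(d_K)},1) ≠ 0`
  obtain ⟨K, _, _, hK, -, hHN, hH2, hLt⟩ := hFH W hw 2 two_ne_zero 0
  have hodd : Odd (NumberField.discr K) := by
    have h8 := Literature.SatisfiesHeegnerHypothesis.discr_emod_eight hK.1 hH2 (dvd_refl 2)
    rw [Int.odd_iff]; omega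
  -- `3 ∣ N(E)` (additive) splits in `K`; hence `d_K ≠ -3`
  have h3N : 3 ∣ W.conductorNorm ℤ :=
    (W.dvd_conductorNorm_iff_not_hasGoodReductionAtPrime 3).mpr (not_good_of_addv W 3 hO6.2.1)
  have hsplit : SplitsIn K 3 := hHN 3 Nat.prime_three h3N
  have hd3 : NumberField.discr K ≠ -3 := by
    intro h
    exact Literature.SatisfiesHeegnerHypothesis.not_dvd_discr hK.1 hHN Nat.prime_three h3N
      (by rw [h]; norm_num)
  -- the Heegner point over `K` and its datum; non-torsion by Gross–Zagier
  obtain ⟨P, Dt, H, ι, hP⟩ := hHP W K hK hHN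
  have hL0 : W.entireLFunction 1 = 0 := entireLFunction_one_eq_zero_of_analyticRank_eq_one hr
  obtain ⟨-, hderiv⟩ := leadingLCoeff_eq_deriv_of_analyticRank_eq_one hr
  have hLK : LDerivEK W K ≠ 0 := by
    rw [lDerivEK_eq_deriv_mul W K hmod hL0]; exact mul_ne_zero hderiv hLt
  have hnt : ¬ IsOfFinAddOrder P :=
    (lDerivEK_ne_zero_iff_not_isOfFinAddOrder W (W.conductorNorm ℤ) K (hGZ _ W K) hK hHN
      ⟨Dt, H, ι, hP⟩).mp hLK
  -- Kolyvagin: `rank E(K) = 1`, `Ш(E/K)` finite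
  obtain ⟨hrk, hfin⟩ := hKo (W.conductorNorm ℤ) W K hK hHN ⟨Dt, H, ι, hP⟩ hnt
  -- a frame `(κ, γ, 𝔭)` and the other prime `𝔭′ ≠ 𝔭` above `3`
  obtain ⟨κ, γ, -, hκ, hγ, -⟩ := X11b.exists_anticyclotomic_generator_prime (p := 3) hK
  haveI : Fact (κ.IsTopGenerator γ) := ⟨hγ⟩
  obtain ⟨𝔭, h𝔭, he, hf⟩ := X11b.exists_degreeOnePrime_of_splitsIn K 3 hK.1 hsplit
  obtain ⟨𝔭', hne, h𝔭', he', hf'⟩ := X11b.Three.exists_ne_degreeOne_prime hK.1 h𝔭 he hf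
  -- (b) PLUMBING. Waldspurger frame and unit value at `(κ, γ, 𝔭)`
  obtain ⟨ι', hind, ΩK, Ωp, L, hΩK, hΩp, hBDP, u, hval⟩ :=
    hV W (W.conductorNorm ℤ) K Dt H ι P hO6 hsurj hr rfl hK hHN hLt hP hnt κ hκ γ 𝔭 h𝔭 he hf
  -- control count at `𝔭′` (CTL₀ included; supplies the torsion guard of the Eisenstein residual)
  have hctl : SchneiderFree.AdditiveControlOnTreeAt 3 κ 𝔭' γ (embAt K 3 𝔭' h𝔭' he' hf') P :=
    hC W (W.conductorNorm ℤ) K Dt H ι P hO6 hsurj hr rfl hK hHN hLt hP hnt (hKo _ W K) κ hκ γ 𝔭'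
      h𝔭' he' hf'
  obtain ⟨n, hn, hneq⟩ := hctl
  -- the value read through the logarithm at `𝔭′` (rank one: `(log_{𝔭′} P)² = (log_𝔭 P)²`)
  have hval' : L.HasValueAt 0 ((((u : unrIntegers 3) : unrIntegers 3) : ℂ_[3]) *
      (algebraMap ℚ_[3] ℂ_[3]
        (logOmega W 3 (embAt K 3 𝔭' h𝔭' he' hf') P / (Dt.c : ℚ_[3]))) ^ 2) :=
    (SchneiderFreeAdditiveX3.hasValueAt_sq_logOmega_embAt_iff_of_rank_one W 3 hK.1 hrk h𝔭 he hf
      h𝔭' he' hf' P _ _ L).mpr hval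
  -- the LOWER socket at slack `v₃(c)` at the frame `(κ, 𝔭′, γ, embAt 𝔭′)` — from `E_𝟙^V`
  have hc0 : Dt.c ≠ 0 := Dt.maninConstant_ne_zero_holds
  have hlog : logOmega W 3 (embAt K 3 𝔭' h𝔭' he' hf') P ≠ 0 := X11b.R1.logOmega_ne_zero W 3 _ hnt
  have hlow : SchneiderFree.AdditiveIMCLowerBDPOnTreeLeAt 3 κ 𝔭' γ (embAt K 3 𝔭' h𝔭' he' hf')
      (padicValNat 3 Dt.c.natAbs) P := by
    obtain ⟨htors, f, hfI, hf0, hfn⟩ := hn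
    -- `E_𝟙^V` at the frame, WITH the datum the kernel holds here: `‖f(𝟙)‖₃ ≤ ‖L(𝟙)‖`
    have hle1 : ‖((constantCoeff f : ℤ_[3]) : ℚ_[3])‖ ≤ ‖((constantCoeff L : unrIntegers 3) : ℂ_[3])‖ :=
      hE1V W (W.conductorNorm ℤ) K Dt H ι P hO6 hsurj hr rfl hK hHN hLt hP hnt hodd κ hκ γ 𝔭 h𝔭 he hf
        𝔭' h𝔭' hne ι' hind ΩK Ωp L hΩK hΩp hBDP htors u hval f hfI
    obtain ⟨-, hle⟩ := two_mul_valuation_le_of_norm_constantCoeff_le 3 hf0 hle1 u hval'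
    have hc0' : (Dt.c : ℚ_[3]) ≠ 0 := by exact_mod_cast hc0
    rw [div_eq_mul_inv, Padic.valuation_mul hlog (inv_ne_zero hc0'), Padic.valuation_inv,
      Padic.valuation_intCast, valuation_logOmega hlog, hfn] at hle
    refine ⟨n, ⟨htors, f, hfI, hf0, hfn⟩, ?_⟩
    simp only [padicValInt] at hle
    linarith
  have hlo : SchneiderFree.IndexLowerBoundLeAt W 3 K P (padicValNat 3 Dt.c.natAbs) :=
    SchneiderFreeAdditiveX3.indexLowerBoundLeAt_of_imcLowerLe_of_control rfl hK hHN hfin hlow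
      ⟨n, hn, hneq⟩
  -- the UPPER socket at slack `v₃(c)` IS the Kolyvagin crux (tower surjectivity, `d_K` odd, `≠ -3`)
  have hupI : SchneiderFree.Upper.IndexUpperBoundLeAt W 3 K P (padicValNat 3 Dt.c.natAbs) :=
    hKoly W (W.conductorNorm ℤ) K Dt H ι P hO6 hsurj hr rfl hK hHN hLt hP hnt hodd hd3 htower
  -- (c) TERMINAL STEP: a globally minimal model of the twist, then p528981
  have hD0 : (NumberField.discr K : ℚ) ≠ 0 := by exact_mod_cast NumberField.discr_ne_zero K
  haveI : (W.quadraticTwist (NumberField.discr K : ℚ)).IsElliptic := W.isElliptic_quadraticTwist hD0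
  obtain ⟨Cd, hCd⟩ := hasGlobalMinimalModel_rat_holds (W.quadraticTwist (NumberField.discr K : ℚ))
  haveI : (Cd • W.quadraticTwist (NumberField.discr K : ℚ)).IsGloballyMinimal := hCd
  exact SchneiderFree.Exact.bsdp_three_of_exactIndexManin_of_wAllExclAddWildRankZero hGZ hKo hGZK hmod
    hGZ73 hZ W hO6 hsurj hr (W.conductorNorm ℤ) K Dt H ι P
    (Cd • W.quadraticTwist (NumberField.discr K : ℚ)) rfl hK hodd hHN hLt hP ⟨Cd, rfl⟩ hlo hupI

/-- **Modulo {PUB, Ko, V, C, Z, NT}: the leaf ⟺ `E_𝟙^V`.** The route's Eisenstein crux, in the only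
currency the kernel consumes, is EQUIVALENT to the target on the cell given the route's other items —
one Gross–Zagier equation for two unknowns: (§3) the leaf and Z fix the Heegner index exactly, which is
both sockets; (§4) both sockets give the leaf. Nothing is asserted about any curve. [folklore] -/
theorem wAllExclAddWildRankOneSurj_iff_valueAtOneV (hF : PublishedInputsWildThree)
    (hKoly : WildKolyvaginUpperAtThree) (hV : WildSplitWaldspurgerAtThree) (hC : WildSplitControlAtThree)
    (hZ : WildRankZeroTwistAtThree) (hNT : WildRankOneSurjNonTowerAtThree) :
    Summit.BirchSwinnertonDyer.WAllExclAddWildRankOneSurj ↔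
      ∀ (W : WeierstrassCurve ℚ) [W.IsElliptic] [W.IsGloballyMinimal] (N : ℕ) [NeZero N] (K : Type) [Field K] [NumberField K] (Dt : Literature.NumberTheory.EllipticCurves.ModularForms.ModularParametrizationData W N) (H : Literature.NumberTheory.EllipticCurves.HeegnerDatum N (NumberField.discr K)) (ι : K →+* ℂ) (P : (W.baseChange K).toAffine.Point), Summit.BirchSwinnertonDyer.Rank1Residual.Additive.ClassO6 W 3 → W.HasSurjectiveModNGaloisRep 3 → W.analyticRank = 1 → W.conductorNorm ℤ = N → Literature.NumberTheory.EllipticCurves.IsImaginaryQuadratic K → Literature.NumberTheory.EllipticCurves.SatisfiesHeegnerHypothesis N K → (W.quadraticTwist (NumberField.discr K : ℚ)).entireLFunction 1 ≠ 0 → (WeierstrassCurve.Affine.Point.map ι.toRatAlgHom) P = Literature.NumberTheory.EllipticCurves.ModularForms.heegnerPointComplex Dt H → ¬ IsOfFinAddOrder P → Odd (NumberField.discr K) → ∀ (κ : Literature.NumberTheory.EllipticCurves.ZpExtension K 3), κ.IsAnticyclotomic → ∀ (γ : Field.absoluteGaloisGroup K) [Fact (κ.IsTopGenerator γ)] (𝔭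 : IsDedekindDomain.HeightOneSpectrum (NumberField.RingOfIntegers K)) (h𝔭 : ((3 : ℕ) : NumberField.RingOfIntegers K) ∈ 𝔭.asIdeal) (he : 𝔭.asIdeal.ramificationIdx (NumberField.RingOfIntegers ℚ) = 1) (hf : 𝔭.asIdeal.inertiaDeg (NumberField.RingOfIntegers ℚ) = 1), ∀ (𝔭' : IsDedekindDomain.HeightOneSpectrum (NumberField.RingOfIntegers K)), ((3 : ℕ) : NumberField.RingOfIntegers K) ∈ 𝔭'.asIdeal → 𝔭' ≠ 𝔭 → ∀ (ι' : PadicAlgCl 3 ≃+* ℂ), Summit.BirchSwinnertonDyer.BirchSwinnertonDyer.Theorems.SchneiderFree.BranchInducesPrime 3 ι' 𝔭 → ∀ (ΩK : ℂ) (Ωp : ℂ_[3]) (L : Literature.NumberTheory.EllipticCurves.UnrSeries 3), ΩK ≠ 0 → Ωp ≠ 0 → Literature.NumberTheory.EllipticCurves.IsBDPLFunction ι' 𝔭 κ γ Dt.f ΩK Ωp L → Module.IsTorsion (Literature.NumberTheory.EllipticCurves.IwasawaAlgebra 3) (Summit.BirchSwinnertonDyer.Rank1Residual.X11b.AcSelmer.XAc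 (W.baseChange K) 3 κ 𝔭' ∅ γ) → ∀ (u : (Literature.NumberTheory.EllipticCurves.unrIntegers 3)ˣ), L.HasValueAt 0 ((((u : Literature.NumberTheory.EllipticCurves.unrIntegers 3) : Literature.NumberTheory.EllipticCurves.unrIntegers 3) : ℂ_[3]) * (algebraMap ℚ_[3] ℂ_[3] (Summit.BirchSwinnertonDyer.Rank1Residual.X11b.Halves.logOmega W 3 (Summit.BirchSwinnertonDyer.Rank1Residual.X11b.embAt K 3 𝔭 h𝔭 he hf) P / (Dt.c : ℚ_[3]))) ^ 2) → ∀ (f : Literature.NumberTheory.EllipticCurves.IwasawaAlgebra 3), Summit.BirchSwinnertonDyer.Rank1Residual.X11b.AcSelmer.XAc.charIdeal (W.baseChange K) 3 κ 𝔭' ∅ γ = Ideal.span {f} → ‖((PowerSeries.constantCoeff f : ℤ_[3]) : ℚ_[3])‖ ≤ ‖((PowerSeries.constantCoeff L : Literature.NumberTheory.EllipticCurves.unrIntegers 3) : ℂ_[3])‖ :=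
  ⟨valueAtOneV_of_wAllExclAddWildRankOneSurj hF hC hZ,
    fun h ↦ wAllExclAddWildRankOneSurj_of_valueAtOneV hF h hKoly hV hC hZ hNT⟩

/-! ### §5 What the cruxes of record assert beyond `E_𝟙^V`: E′ ⟹ `E_𝟙^V`, E ⟹ `E_𝟙^V` (by name) -/

/-- **E′ ⟹ `E_𝟙^V`** (the restricted crux `WildSplitEisensteinInclusionAtThreeRestricted`, item 24155, BY
NAME): read E′ at the trivial character (`norm_constantCoeff_le_of_map_mem_span`) and discard the two
extra hypotheses. With §3–§4: E′ exceeds kernel need exactly by the even-`d_K` fields, the frames without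
a unit value display, and its Λ-adic content above `T = 0`.
[cite: JetchevSkinnerWan2017, §7.4.1 (arXiv:1512.06894 p. 30)] -/
theorem valueAtOneV_of_restricted (hE' : WildSplitEisensteinInclusionAtThreeRestricted) :
    ∀ (W : WeierstrassCurve ℚ) [W.IsElliptic] [W.IsGloballyMinimal] (N : ℕ) [NeZero N] (K : Type) [Field K] [NumberField K] (Dt : Literature.NumberTheory.EllipticCurves.ModularForms.ModularParametrizationData W N) (H : Literature.NumberTheory.EllipticCurves.HeegnerDatum N (NumberField.discr K)) (ι : K →+* ℂ) (P : (W.baseChange K).toAffine.Point), Summit.BirchSwinnertonDyer.Rank1Residual.Additive.ClassO6 W 3 → W.HasSurjectiveModNGaloisRep 3 → W.analyticRank = 1 → W.conductorNorm ℤ = N → Literature.NumberTheory.EllipticCurves.IsImaginaryQuadratic K → Literature.NumberTheory.EllipticCurves.SatisfiesHeegnerHypothesis N K → (W.quadraticTwist (NumberField.discr K : ℚ)).entireLFunction 1 ≠ 0 → (WeierstrassCurve.Affine.Point.map ι.toRatAlgHom) P = Literature.NumberTheory.EllipticCurves.ModularForms.heegnerPointComplex Dt H → ¬ IsOfFinAddOrder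 P → Odd (NumberField.discr K) → ∀ (κ : Literature.NumberTheory.EllipticCurves.ZpExtension K 3), κ.IsAnticyclotomic → ∀ (γ : Field.absoluteGaloisGroup K) [Fact (κ.IsTopGenerator γ)] (𝔭 : IsDedekindDomain.HeightOneSpectrum (NumberField.RingOfIntegers K)) (h𝔭 : ((3 : ℕ) : NumberField.RingOfIntegers K) ∈ 𝔭.asIdeal) (he : 𝔭.asIdeal.ramificationIdx (NumberField.RingOfIntegers ℚ) = 1) (hf : 𝔭.asIdeal.inertiaDeg (NumberField.RingOfIntegers ℚ) = 1), ∀ (𝔭' : IsDedekindDomain.HeightOneSpectrum (NumberField.RingOfIntegers K)), ((3 : ℕ) : NumberField.RingOfIntegers K) ∈ 𝔭'.asIdeal → 𝔭' ≠ 𝔭 → ∀ (ι' : PadicAlgCl 3 ≃+* ℂ), Summit.BirchSwinnertonDyer.BirchSwinnertonDyer.Theorems.SchneiderFree.BranchInducesPrime 3 ι' 𝔭 → ∀ (ΩK : ℂ) (Ωp : ℂ_[3]) (L : Literature.NumberTheory.EllipticCurves.UnrSeries 3), ΩK ≠ 0 → Ωp ≠ 0 → Literature.NumberTheory.EllipticCurves.IsBDPLFunction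 ι' 𝔭 κ γ Dt.f ΩK Ωp L → Module.IsTorsion (Literature.NumberTheory.EllipticCurves.IwasawaAlgebra 3) (Summit.BirchSwinnertonDyer.Rank1Residual.X11b.AcSelmer.XAc (W.baseChange K) 3 κ 𝔭' ∅ γ) → ∀ (u : (Literature.NumberTheory.EllipticCurves.unrIntegers 3)ˣ), L.HasValueAt 0 ((((u : Literature.NumberTheory.EllipticCurves.unrIntegers 3) : Literature.NumberTheory.EllipticCurves.unrIntegers 3) : ℂ_[3]) * (algebraMap ℚ_[3] ℂ_[3] (Summit.BirchSwinnertonDyer.Rank1Residual.X11b.Halves.logOmega W 3 (Summit.BirchSwinnertonDyer.Rank1Residual.X11b.embAt K 3 𝔭 h𝔭 he hf) P / (Dt.c : ℚ_[3]))) ^ 2) → ∀ (f : Literature.NumberTheory.EllipticCurves.IwasawaAlgebra 3), Summit.BirchSwinnertonDyer.Rank1Residual.X11b.AcSelmer.XAc.charIdeal (W.baseChange K) 3 κ 𝔭' ∅ γ = Ideal.span {f} → ‖((PowerSeries.constantCoeff f : ℤ_[3]) : ℚ_[3])‖ ≤ ‖((PowerSeries.constantCoeff L : Literature.NumberTheory.EllipticCurves.unrIntegers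 3) : ℂ_[3])‖ := by
  intro W _ _ N _ K _ _ Dt H ι P hO6 hsurj hr hN hK hHH hLt hP hnt _hodd κ hκ γ _ 𝔭 h𝔭 he hf 𝔭' h𝔭' hne ι'
    hι' ΩK Ωp L hΩK hΩp hBDP htor _u _hval f hfI
  have hincl := hE' W N K Dt H ι P hO6 hsurj hr hN hK hHH hLt hP hnt κ hκ γ 𝔭 h𝔭 he hf 𝔭' h𝔭' hne ι'
    hι' ΩK Ωp L hΩK hΩp hBDP htor
  rw [hfI, CongruenceLimit.map_span_singleton_powerSeries] at hincl
  exact norm_constantCoeff_le_of_map_mem_span 3 ((Ideal.span_singleton_le_iff_mem _).mp hincl)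

/-- **E ⟹ `E_𝟙^V`** (the crux of record `WildSplitEisensteinInclusionAtThree`, item 20479, BY NAME), through
E ⟹ E′ (`restricted_of_crux`, p588074). [folklore] -/
theorem valueAtOneV_of_crux (hE : WildSplitEisensteinInclusionAtThree) :
    ∀ (W : WeierstrassCurve ℚ) [W.IsElliptic] [W.IsGloballyMinimal] (N : ℕ) [NeZero N] (K : Type) [Field K] [NumberField K] (Dt : Literature.NumberTheory.EllipticCurves.ModularForms.ModularParametrizationData W N) (H : Literature.NumberTheory.EllipticCurves.HeegnerDatum N (NumberField.discr K)) (ι : K →+* ℂ) (P : (W.baseChange K).toAffine.Point), Summit.BirchSwinnertonDyer.Rank1Residual.Additive.ClassO6 W 3 → W.HasSurjectiveModNGaloisRep 3 → W.analyticRank = 1 → W.conductorNorm ℤ = N → Literature.NumberTheory.EllipticCurves.IsImaginaryQuadratic K → Literature.NumberTheory.EllipticCurves.SatisfiesHeegnerHypothesis N K → (W.quadraticTwist (NumberField.discr K : ℚ)).entireLFunction 1 ≠ 0 → (WeierstrassCurve.Affine.Point.map ι.toRatAlgHom) P = Literature.NumberTheory.EllipticCurves.ModularForms.heegnerPointComplex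 Dt H → ¬ IsOfFinAddOrder P → Odd (NumberField.discr K) → ∀ (κ : Literature.NumberTheory.EllipticCurves.ZpExtension K 3), κ.IsAnticyclotomic → ∀ (γ : Field.absoluteGaloisGroup K) [Fact (κ.IsTopGenerator γ)] (𝔭 : IsDedekindDomain.HeightOneSpectrum (NumberField.RingOfIntegers K)) (h𝔭 : ((3 : ℕ) : NumberField.RingOfIntegers K) ∈ 𝔭.asIdeal) (he : 𝔭.asIdeal.ramificationIdx (NumberField.RingOfIntegers ℚ) = 1) (hf : 𝔭.asIdeal.inertiaDeg (NumberField.RingOfIntegers ℚ) = 1), ∀ (𝔭' : IsDedekindDomain.HeightOneSpectrum (NumberField.RingOfIntegers K)), ((3 : ℕ) : NumberField.RingOfIntegers K) ∈ 𝔭'.asIdeal → 𝔭' ≠ 𝔭 → ∀ (ι' : PadicAlgCl 3 ≃+* ℂ), Summit.BirchSwinnertonDyer.BirchSwinnertonDyer.Theorems.SchneiderFree.BranchInducesPrime 3 ι' 𝔭 → ∀ (ΩK : ℂ) (Ωp : ℂ_[3]) (L : Literature.NumberTheory.EllipticCurves.UnrSeries 3), ΩK ≠ 0 → Ωp ≠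 0 → Literature.NumberTheory.EllipticCurves.IsBDPLFunction ι' 𝔭 κ γ Dt.f ΩK Ωp L → Module.IsTorsion (Literature.NumberTheory.EllipticCurves.IwasawaAlgebra 3) (Summit.BirchSwinnertonDyer.Rank1Residual.X11b.AcSelmer.XAc (W.baseChange K) 3 κ 𝔭' ∅ γ) → ∀ (u : (Literature.NumberTheory.EllipticCurves.unrIntegers 3)ˣ), L.HasValueAt 0 ((((u : Literature.NumberTheory.EllipticCurves.unrIntegers 3) : Literature.NumberTheory.EllipticCurves.unrIntegers 3) : ℂ_[3]) * (algebraMap ℚ_[3] ℂ_[3] (Summit.BirchSwinnertonDyer.Rank1Residual.X11b.Halves.logOmega W 3 (Summit.BirchSwinnertonDyer.Rank1Residual.X11b.embAt K 3 𝔭 h𝔭 he hf) P / (Dt.c : ℚ_[3]))) ^ 2) → ∀ (f : Literature.NumberTheory.EllipticCurves.IwasawaAlgebra 3), Summit.BirchSwinnertonDyer.Rank1Residual.X11b.AcSelmer.XAc.charIdeal (W.baseChange K) 3 κ 𝔭' ∅ γ = Ideal.span {f} → ‖((PowerSeries.constantCoeff f : ℤ_[3]) : ℚ_[3])‖ ≤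 ‖((PowerSeries.constantCoeff L : Literature.NumberTheory.EllipticCurves.unrIntegers 3) : ℂ_[3])‖ :=
  valueAtOneV_of_restricted (restricted_of_crux hE)

end Summit.BirchSwinnertonDyer.BirchSwinnertonDyer.Theorems.WildSplitEisensteinInclusionAtThreeTight

end
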